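import Summits.QuantumFields.YangMills.Theorems.BalabanLadderIRPurityClimb24
import HarnessLib

/-!
# Purity bootstraps at fixed `β`: `E` at ONE tolerance `1/24` on ONE box ⇔ `E` at ALL tolerances on cofinal boxes (content-free helper)

Ideator ym-ir-idea-11 g0, line `thermal-ratchet` (§2h/§2i) on crux `BalabanLadder.IR` (stmt-QuantumFields-19354, rung R2c).  A pure
composition, by name, of landed theorems: `PurityClimb.coldDefect_widen_24` (p605701: `1/24 → 2⁻²⁵` in fourteen doublings) and the ITERATED
sharp rung `BasinRung.basin_step9` (`δ(2L) ≤ 395·u²` for `δ(L) ≤ u ≤ 2⁻⁹`), on the Wilson family (`axisSymmetric`, `tracePositive`,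
`volumeBounds`).  Results, for every compact `G`, every lattice representation, every `β ≥ 0`:
* `boxDefect_iterate9` — below `2⁻⁹` the defect decays doubly exponentially along doublings: `δ(2ⁿL) ≤ 2⁻⁹·(395/2⁹)^(2ⁿ−1)`;
* `coldDefect_anyPurity` — ONE `1/24`-pure cold box of side `L ≥ 8` ⇒ for every `ε > 0` and every `L₀`, an `ε`-pure cold box of side
  `≥ L₀`, same `β`;
* `coldExitSC_of_coldExitAt24 : ColdExitAt (1/24) → ColdExitSC` and `coldExitSC_iff_coldExitAt24` — the exit obligation `E` of lines
  `doubling-bridge` / `entropy-staircase` / `flux-purity-split` / `harmonic-purity-channel` (all tolerances, cofinal scales) IS the one-bit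
  few-percent statement `E(1/24)` of line `basin-transfer` (idea-9): purity at the `4 %` level on one box `≥ 8`, eventually in `β`.

HONEST FRAMING.  Content-free real arithmetic over landed theorems; nothing here proves the Yang–Mills mass gap (Clay), the crux `IR`, `E`
itself, any heredity sign or a lattice gap; R4 (`BalabanUVStability4`) closes only the conditional finite-`𝕋⁴` rung `BalabanLadder.UV`.
-/

open MeasureTheory Filter Topology
open Literature.MathematicalPhysics.QuantumFieldTheory Literature.MathematicalPhysics.QuantumLattice
open Summit.QuantumFields.YangMills.Cruxes.IR.ColdPurityBridge (coldDefect ColdExitSC)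
open Summit.QuantumFields.YangMills.Cruxes.IR.AspectBootstrap (boxDefect IsAxisSymmetric IsTracePositive HasVolumeBounds
  coldDefect_eq_boxDefect axisSymmetric tracePositive volumeBounds)
open Summit.QuantumFields.YangMills.Cruxes.IR.BasinRung (ColdExitAt basin_step9 coldExitAt_of_coldExitSC coldExitAt_mono)

namespace Summit.QuantumFields.YangMills.Cruxes.IR.PurityClimb

/-! ## §1 Iterated sharp rung below `2⁻⁹` (abstract family) -/

section Iterate

variable {Z : ℕ → ℕ → ℕ → ℕ → ℝ}

/-- Below `2⁻⁹` the defect decays DOUBLY EXPONENTIALLY along doublings: `δ(2ⁿ·L) ≤ 2⁻⁹·(395/2⁹)^(2ⁿ−1)` (`basin_step9` iterated;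
`395/2⁹ < 1`). -/
theorem boxDefect_iterate9 (hS : IsAxisSymmetric Z) (hT : IsTracePositive Z) (hV : HasVolumeBounds Z) (L : ℕ) (hL : 8 ≤ L)
    (h : boxDefect Z L ≤ 1 / 2 ^ 9) :
    ∀ n : ℕ, boxDefect Z (2 ^ n * L) ≤ 1 / 2 ^ 9 * (395 / 2 ^ 9) ^ (2 ^ n - 1)
  | 0 => by simpa using h
  | n + 1 => by
    have ih := boxDefect_iterate9 hS hT hV L hL h n
    have hc1 : (395 / 2 ^ 9 : ℝ) ^ (2 ^ n - 1) ≤ 1 := pow_le_one₀ (by norm_num) (by norm_num)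
    have hu9 : (1 / 2 ^ 9 : ℝ) * (395 / 2 ^ 9) ^ (2 ^ n - 1) ≤ 1 / 2 ^ 9 := by
      have : (0 : ℝ) ≤ 1 / 2 ^ 9 := by norm_num
      nlinarith
    have h8 : 8 ≤ 2 ^ n * L := by
      have h1 : 1 ≤ 2 ^ n := Nat.one_le_two_pow
      calc 8 ≤ L := hL
        _ = 1 * L := (one_mul L).symm
        _ ≤ 2 ^ n * L := Nat.mul_le_mul_right L h1
    have step := basin_step9 hS hT hV (2 ^ n * L) h8 ih hu9
    have hL2 : 2 ^ (n + 1) * L = 2 * (2 ^ n * L) := by ring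
    have hm : 2 ^ (n + 1) - 1 = 2 * (2 ^ n - 1) + 1 := by
      have := Nat.one_le_two_pow (n := n)
      rw [pow_succ]; omega
    rw [hL2, hm]
    refine step.trans (le_of_eq ?_)
    generalize (2 ^ n - 1) = m
    rw [pow_add, pow_one, mul_comm 2 m, pow_mul]
    ring

/-- For every `ε > 0` the iterated bound drops below `ε` at some `n ≥ n₀`. -/
theorem iterate9_bound_small {ε : ℝ} (hε : 0 < ε) (n₀ : ℕ) :
    ∃ n : ℕ, n₀ ≤ n ∧ (1 / 2 ^ 9 : ℝ) * (395 / 2 ^ 9) ^ (2 ^ n - 1) ≤ ε := by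
  obtain ⟨m, hm⟩ := exists_pow_lt_of_lt_one hε (by norm_num : (395 / 2 ^ 9 : ℝ) < 1)
  refine ⟨max m n₀, le_max_right _ _, ?_⟩
  have hmle : m ≤ 2 ^ max m n₀ - 1 := by
    have h1 : m ≤ max m n₀ := le_max_left _ _
    have h2 : max m n₀ < 2 ^ max m n₀ := Nat.lt_two_pow_self
    omega
  have hpow : (395 / 2 ^ 9 : ℝ) ^ (2 ^ max m n₀ - 1) ≤ (395 / 2 ^ 9) ^ m :=
    pow_le_pow_of_le_one (by norm_num) (by norm_num) hmle
  have : (0 : ℝ) ≤ (395 / 2 ^ 9) ^ (2 ^ max m n₀ - 1) := by positivity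
  nlinarith

end Iterate

/-! ## §2 Wilson family: one `1/24`-pure cold box ⇒ arbitrarily pure, arbitrarily large cold boxes at the same `β` -/

section Model

variable {G : Type} [Group G] [TopologicalSpace G] [IsTopologicalGroup G] [CompactSpace G] [MeasurableSpace G] [BorelSpace G]

/-- **Any purity, any size, same `β`**: `δᶜ_β(L) ≤ 1/24` with `L ≥ 8`, `β ≥ 0` ⇒ for every `ε > 0` and `L₀` some `L' ≥ max L₀ 8` has
`δᶜ_β(L') ≤ ε` (`L' = 2ⁿ·2¹⁴·L`). -/
theorem coldDefect_anyPurity (r : LatticeRep G) {β : ℝ} (hβ : 0 ≤ β) (L : ℕ) (hL : 8 ≤ L)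
    (h : coldDefect r.ρ β L ≤ 1 / 24) {ε : ℝ} (hε : 0 < ε) (L₀ : ℕ) :
    ∃ L' : ℕ, L₀ ≤ L' ∧ 8 ≤ L' ∧ coldDefect r.ρ β L' ≤ ε := by
  have hS := axisSymmetric r β
  have hT := tracePositive r hβ
  have hV := volumeBounds r hβ
  have h25 := coldDefect_widen_24 r hβ L hL h
  have h9 : boxDefect (wilsonFinTorusPartition r.ρ β) (16384 * L) ≤ 1 / 2 ^ 9 := by
    rw [← coldDefect_eq_boxDefect]; exact h25.trans (by norm_num)
  have h8 : 8 ≤ 16384 * L := by omega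
  obtain ⟨n, hn₀, hn⟩ := iterate9_bound_small hε L₀
  refine ⟨2 ^ n * (16384 * L), ?_, ?_, ?_⟩
  · have h1 : n < 2 ^ n := Nat.lt_two_pow_self
    have h2 : 2 ^ n ≤ 2 ^ n * (16384 * L) := Nat.le_mul_of_pos_right _ (by omega)
    omega
  · have h1 : 1 ≤ 2 ^ n := Nat.one_le_two_pow
    calc 8 ≤ 16384 * L := h8
      _ = 1 * (16384 * L) := (one_mul _).symm
      _ ≤ 2 ^ n * (16384 * L) := Nat.mul_le_mul_right _ h1
  · rw [coldDefect_eq_boxDefect]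
    exact (boxDefect_iterate9 hS hT hV (16384 * L) h8 h9 n).trans hn

end Model

/-! ## §3 `E(1/24)` IS `E`: the exit obligation at one tolerance on one box ⇔ at all tolerances on cofinal boxes -/

/-- **`ColdExitAt (1/24) → ColdExitSC`**: the one-bit few-percent exit (idea-9's seed, line `basin-transfer`) implies the full exit `E` of lines
`doubling-bridge` / `entropy-staircase` / `flux-purity-split` / `harmonic-purity-channel` (all `ε > 0`, boxes beyond every `L₀`), eventually in `β`. -/
theorem coldExitSC_of_coldExitAt24 (hE : ColdExitAt (1 / 24)) : ColdExitSC := by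
  intro G _ _ _ _ hG hsc
  letI : MeasurableSpace G := borel G
  haveI : BorelSpace G := ⟨rfl⟩
  intro r ε hε
  obtain ⟨β₁, hβ₁⟩ := hE G hG hsc r
  refine ⟨max β₁ 0, fun β hβ L₀ => ?_⟩
  obtain ⟨L, hL, hδ⟩ := hβ₁ β ((le_max_left _ _).trans hβ)
  obtain ⟨L', hL₀, -, hδ'⟩ := coldDefect_anyPurity r ((le_max_right _ _).trans hβ) L hL hδ hε L₀
  exact ⟨L', hL₀, hδ'⟩

/-- Any seed tolerance `θ ≤ 1/24` will do. -/
theorem coldExitSC_of_coldExitAt_le {θ : ℝ} (hθ : θ ≤ 1 / 24) (hE : ColdExitAt θ) : ColdExitSC :=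
  coldExitSC_of_coldExitAt24 (coldExitAt_mono hθ hE)

/-- **`E ⇔ E(1/24)`** (with the landed `coldExitAt_of_coldExitSC`). -/
theorem coldExitSC_iff_coldExitAt24 : ColdExitSC ↔ ColdExitAt (1 / 24) :=
  ⟨fun h => coldExitAt_of_coldExitSC (by norm_num) h, coldExitSC_of_coldExitAt24⟩

end Summit.QuantumFields.YangMills.Cruxes.IR.PurityClimb
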